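import Literature.AlgebraicGeometry.ShimuraVarieties.KudlaRapoport2013.Sec13LevelStructures
import Literature.AlgebraicGeometry.ShimuraVarieties.KudlaRapoport2013.Sec9LocalCharacterHilbertSymbol
import Literature.NumberTheory.QuadraticForms.PadicSquareCriteria
import Literature.NumberTheory.QuadraticForms.HermitianUnimodularLocalRing
import Mathlib.NumberTheory.Padics.RingHoms
import Mathlib.FieldTheory.Finite.Basic
import Mathlib.RingTheory.DedekindDomain.Factorization
import Mathlib.RingTheory.LocalRing.Basic
import HarnessLib

/-!
# Unimodular `σ`-hermitian matrices over `O_k` are congruent to the standard (antidiagonal) form modulo `N`, `(N, 2Δ) = 1`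

Kernel-lane INPUT file for the discharge of the CLOSED named fact ★ `KR2013_13_5_reduction` of the statement carpet
★ `Literature/AlgebraicGeometry/ShimuraVarieties/KudlaRapoport2013/Sec13LevelStructures.lean` ([KudlaRapoport2013, §13.2 after
Def. 13.5 (arXiv v2 p. 50)] «if `L` is a self-dual `O_k`-module, then `L/NL` is isomorphic to `(O_k/N O_k)ⁿ` with the standard form»):
the MATRIX form of that sentence.  THEOREMS ONLY (no definition, no named fact, no `sorry`, no instance, no notation); cell
hodgecm-mathlib, seat B-typ01 (g33); net debt 0.

## What is proved (`HermitianGram.exists_congr_stdHermMatrix_mod`)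

Let `k` be an imaginary-quadratic field, `σ` its complex conjugation on `O_k` (★ `sigmaInt`), `N` an odd positive integer prime to the
discriminant `Δ` of `k`, and `G ∈ M_n(O_k)` a `σ`-hermitian matrix (`ᵗ(σG) = G`) whose determinant is a unit modulo `N`.  Then there is
`T ∈ M_n(O_k)` with `ᵗ(σT) G T ≡ antidiag(1, …, 1) (mod N O_k)` (★ `stdHermMatrix`, the standard form of Def. 13.5); `T` is invertible
modulo `N` for determinant reasons.

## The argument

Chinese remainder gluing over the primes `v ∣ N O_k` (pairwise-coprime prime powers `v^M`, `M` large; Mathlib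
`IsDedekindDomain.exists_forall_sub_mem_ideal`, `Ideal.iInf_maxPowDividing_eq`): `T = Σ_v ε_v T_v` works as soon as
`ᵗ(σ T_{σv}) G T_v ≡ antidiag (mod v^M)` for every `v` (`σ` permutes the `v`).  At a `σ`-STABLE `v` the ring `O_k/v^M` is local with the involution
induced by `σ`, (trace) holds with `b = ½` (`N` odd) and (norm) holds — every `σ`-fixed unit `u` of `O_k/v^M` is a norm `t σ(t)`: `u ≡ m ∈ ℤ`
(`2u ≡ Tr`), and `x² − Δ y² = m` is solvable in `ℤ_p` (a non-degenerate binary form over `𝔽_p` represents `m`, Mathlib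
`FiniteField.exists_root_sum_quadratic`; Hensel for squares, ★ `padicInt_isSquare_unit_iff_toZMod`), so `t = a + b√Δ` works — hence Jacobowitz's
theorem for unramified unimodular hermitian lattices applies (★ `HermitianUnimodular.exists_formCongr_eq`, [Jacobowitz1962, Thm. 7.1]).  At a
split pair `v ≠ σv` one takes `T_v = w · adj(G) · antidiag` (`w · det G ≡ 1`) and `T_{σv} = 1`: no classification is needed there.

## References
* [KudlaRapoport2013] S. Kudla, M. Rapoport, *Special cycles on unitary Shimura varieties II: global theory*, J. reine angew. Math. 697
  (2014) 91–157 = arXiv:0912.3758v2, §13.2 Def. 13.5 and the sentence after it (p. 50).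
* [Jacobowitz1962] R. Jacobowitz, *Hermitian forms over local fields*, Amer. J. Math. 84 (1962) 441–465, §7 Thm. 7.1 (unramified case).
* [Serre1979] J.-P. Serre, *Local Fields*, GTM 67, Ch. V §2 Prop. 3 (units are norms in unramified extensions).
-/

set_option autoImplicit false

noncomputable section

open NumberField IsDedekindDomain Polynomial
open Literature.NumberTheory.Automorphic (formCongr)
open Literature.NumberTheory.Automorphic.Liu2021.AppendixC (conj)
open Literature.AlgebraicGeometry.ShimuraVarieties.KudlaRapoport2013.Sec2Defs (sigmaInt)
open Literature.AlgebraicGeometry.ShimuraVarieties.KudlaRapoport2013.Sec7to10EisensteinSide (exists_mul_self_eq_discr)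
open Literature.NumberTheory.QuadraticForms (padicInt_isSquare_unit_iff_toZMod)
open scoped Matrix

namespace Literature.AlgebraicGeometry.ShimuraVarieties.KudlaRapoport2013.Sec13LevelStructures

/-! ### `x² − Δ y² = m` in `ℤ_p` for units `Δ, m` (`p` odd) -/

section Padic

variable {p : ℕ} [hp : Fact p.Prime]

/-- An element of `ℤ_p` with non-zero residue is a unit. [folklore] -/
private theorem isUnit_of_toZMod_ne_zero {s : ℤ_[p]} (hs : PadicInt.toZMod s ≠ 0) : IsUnit s := by
  by_contra h
  have hmem : s ∈ IsLocalRing.maximalIdeal ℤ_[p] := by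
    rw [IsLocalRing.mem_maximalIdeal]; exact h
  rw [← PadicInt.ker_toZMod, RingHom.mem_ker] at hmem
  exact hs hmem

/-- **`x² − Δ y² = m` is solvable in `ℤ_p`** for `p`-adic units `Δ, m` and `p` odd: the non-degenerate binary form `X² − Δ̄ Y²` over `𝔽_p`
represents `m̄` (Mathlib `FiniteField.exists_root_sum_quadratic`), and a unit of `ℤ_p` whose residue is a non-zero square is a square (Hensel,
★ `padicInt_isSquare_unit_iff_toZMod`). [cite: Serre1979, Ch. V §2 Prop. 3] -/
private theorem exists_sq_sub_mul_sq_eq (hp2 : p ≠ 2) {Δ m : ℤ_[p]} (hΔ : IsUnit Δ) (hm : IsUnit m) :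
    ∃ x y : ℤ_[p], x ^ 2 - Δ * y ^ 2 = m := by
  classical
  have hcard : Fintype.card (ZMod p) % 2 = 1 := by
    rw [ZMod.card]
    exact Nat.odd_iff.1 (hp.out.odd_of_ne_two hp2)
  set Δ₀ := PadicInt.toZMod Δ with hΔ₀def
  set m₀ := PadicInt.toZMod m with hm₀def
  have hΔ₀ : Δ₀ ≠ 0 := (hΔ.map PadicInt.toZMod).ne_zero
  have hm₀ : m₀ ≠ 0 := (hm.map PadicInt.toZMod).ne_zero
  obtain ⟨a, b, hab⟩ := FiniteField.exists_root_sum_quadratic (f := X ^ 2 - C m₀) (g := C (-Δ₀) * X ^ 2)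
    (degree_X_pow_sub_C (by norm_num) m₀) (degree_C_mul_X_pow 2 (neg_ne_zero.2 hΔ₀)) hcard
  simp only [eval_sub, eval_pow, eval_X, eval_C, eval_mul] at hab
  -- `hab : a ^ 2 - m₀ + -Δ₀ * b ^ 2 = 0`; a lift `b'` of `b`
  set b' : ℤ_[p] := ((b.val : ℕ) : ℤ_[p]) with hb'def
  have hb' : PadicInt.toZMod b' = b := by rw [hb'def, map_natCast, ZMod.natCast_zmod_val]
  by_cases ha : a = 0
  · -- `Δ₀ b² = -m₀`: take `x = 0`, `y² = -m/Δ`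
    have hb2 : Δ₀ * b ^ 2 = -m₀ := by rw [ha] at hab; linear_combination -hab
    have hb0 : b ≠ 0 := by
      rintro rfl
      apply hm₀
      have h : -m₀ = 0 := by rw [← hb2]; ring
      exact neg_eq_zero.1 h
    set δi : ℤ_[p] := ↑hΔ.unit⁻¹ with hδi
    set c : ℤ_[p] := -(m * δi) with hc
    have hΔc : Δ * c = -m := by
      rw [hc, mul_neg, mul_left_comm, hδi, IsUnit.mul_val_inv, mul_one]
    have h1 : PadicInt.toZMod δi * Δ₀ = 1 := by
      rw [hΔ₀def, hδi, ← map_mul, IsUnit.val_inv_mul, map_one]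
    have hcres : PadicInt.toZMod c = b ^ 2 := by
      rw [hc, map_neg, map_mul, ← hm₀def]
      linear_combination (b ^ 2) * h1 + (-PadicInt.toZMod δi) * hb2
    have hc0 : PadicInt.toZMod c ≠ 0 := by rw [hcres]; exact pow_ne_zero _ hb0
    have hcu : IsUnit c := isUnit_of_toZMod_ne_zero hc0
    obtain ⟨y, hy⟩ : IsSquare c :=
      (padicInt_isSquare_unit_iff_toZMod hp2 hcu.unit).2 (by rw [IsUnit.unit_spec, hcres]; exact ⟨b, sq b⟩)
    refine ⟨0, y, ?_⟩
    have hy' : y ^ 2 = c := by rw [sq]; exact hy.symm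
    rw [hy']
    linear_combination -hΔc
  · -- `a ≠ 0`: take `y = b'`, `x² = Δ b'² + m`
    set c : ℤ_[p] := Δ * b' ^ 2 + m with hc
    have hcres : PadicInt.toZMod c = a ^ 2 := by
      rw [hc, map_add, map_mul, map_pow, hb', ← hΔ₀def, ← hm₀def]
      linear_combination -hab
    have hc0 : PadicInt.toZMod c ≠ 0 := by rw [hcres]; exact pow_ne_zero _ ha
    have hcu : IsUnit c := isUnit_of_toZMod_ne_zero hc0
    obtain ⟨x, hx⟩ : IsSquare c :=
      (padicInt_isSquare_unit_iff_toZMod hp2 hcu.unit).2 (by rw [IsUnit.unit_spec, hcres]; exact ⟨a, sq a⟩)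
    refine ⟨x, b', ?_⟩
    have hx' : x ^ 2 = c := by rw [sq]; exact hx.symm
    rw [hx', hc]
    ring

/-- The integer version: for `p` odd, `p ∤ Δ`, `p ∤ m` and every `M` there are `a, b ∈ ℤ` with `a² − Δ b² ≡ m (mod p^M)`. [folklore] -/
private theorem exists_int_sq_sub_mul_sq_mod (hp2 : p ≠ 2) {Δ m : ℤ} (hΔ : ¬ (p : ℤ) ∣ Δ) (hm : ¬ (p : ℤ) ∣ m) (M : ℕ) :
    ∃ a b : ℤ, (p : ℤ) ^ M ∣ a ^ 2 - Δ * b ^ 2 - m := by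
  have hunit : ∀ z : ℤ, ¬ (p : ℤ) ∣ z → IsUnit (z : ℤ_[p]) := fun z hz =>
    isUnit_of_toZMod_ne_zero (by rw [map_intCast, Ne, ZMod.intCast_zmod_eq_zero_iff_dvd]; exact hz)
  obtain ⟨x, y, hxy⟩ := exists_sq_sub_mul_sq_eq hp2 (hunit Δ hΔ) (hunit m hm)
  haveI : NeZero (p ^ M) := ⟨pow_ne_zero _ hp.out.ne_zero⟩
  refine ⟨((PadicInt.toZModPow M x).val : ℤ), ((PadicInt.toZModPow M y).val : ℤ), ?_⟩
  have h0 : (((((PadicInt.toZModPow M x).val : ℤ)) ^ 2 - Δ * (((PadicInt.toZModPow M y).val : ℤ)) ^ 2 - m : ℤ) :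
      ZMod (p ^ M)) = 0 := by
    have h := congrArg (PadicInt.toZModPow M) hxy
    rw [map_sub, map_mul, map_pow, map_pow, map_intCast, map_intCast] at h
    simp only [Int.cast_sub, Int.cast_mul, Int.cast_pow, Int.cast_natCast, ZMod.natCast_zmod_val]
    rw [h, sub_self]
  have h := (ZMod.intCast_zmod_eq_zero_iff_dvd _ (p ^ M)).1 h0
  push_cast at h
  exact h

end Padic

/-! ### `σ`-fixed units are norms modulo powers of a prime of `O_k` over an odd `p ∤ Δ` -/

section NormMod

variable (k : Type) [Field k] [NumberField k] [IsTotallyComplex k] [Algebra.IsQuadraticExtension ℚ k]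

/-- `σ(σ x) = x`. [folklore] -/
private theorem conj_conj' (x : k) : conj ℚ k (conj ℚ k x) = x := by
  letI : IsCMField k := IsCMField.ofCMExtension ℚ k
  exact IsCMField.complexConj_apply_apply (K := k) x

/-- `sigmaInt` is `σ` on `O_k`. [folklore] -/
private theorem coe_sigmaInt (a : 𝓞 k) : ((sigmaInt k a : 𝓞 k) : k) = conj ℚ k a := rfl

/-- `σ` is an involution of `O_k`. [folklore] -/
private theorem sigmaInt_sigmaInt (a : 𝓞 k) : sigmaInt k (sigmaInt k a) = a :=
  RingOfIntegers.ext (by rw [coe_sigmaInt, coe_sigmaInt, conj_conj'])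

/-- An element fixed by `σ` is rational. [folklore] -/
private theorem exists_rat_eq_of_conj_eq' {x : k} (hx : conj ℚ k x = x) : ∃ q : ℚ, algebraMap ℚ k q = x := by
  letI : IsCMField k := IsCMField.ofCMExtension ℚ k
  have hx' : IsCMField.complexConj k x = x := hx
  have hmem : x ∈ maximalRealSubfield k := (IsCMField.complexConj_eq_self_iff (K := k) x).1 hx'
  exact ⟨(CMExtension.equivMaximalRealSubfield ℚ k).symm ⟨x, hmem⟩, by
    rw [CMExtension.algebraMap_equivMaximalRealSubfield_symm_apply]; rfl⟩

/-- A `σ`-fixed algebraic integer is a rational integer. [folklore] -/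
private theorem exists_int_eq_of_sigmaInt_eq {x : 𝓞 k} (hx : sigmaInt k x = x) : ∃ m : ℤ, (m : 𝓞 k) = x := by
  have h2 : conj ℚ k (x : k) = (x : k) := by rw [← coe_sigmaInt, hx]
  obtain ⟨q, hq⟩ := exists_rat_eq_of_conj_eq' k h2
  have hint : IsIntegral ℤ q := by
    have h : IsIntegral ℤ (algebraMap ℚ k q) := by
      rw [hq, RingOfIntegers.coe_eq_algebraMap]
      exact RingOfIntegers.isIntegral_coe x
    exact (isIntegral_algebraMap_iff (algebraMap ℚ k).injective).1 h
  obtain ⟨d, hd⟩ := (IsIntegrallyClosed.isIntegral_iff (R := ℤ) (K := ℚ)).1 hint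
  refine ⟨d, RingOfIntegers.ext ?_⟩
  rw [← hq, ← hd]
  simp

/-- `x + σ x ∈ ℤ` (the trace). [folklore] -/
private theorem exists_int_eq_add_sigmaInt (x : 𝓞 k) : ∃ m : ℤ, (m : 𝓞 k) = x + sigmaInt k x :=
  exists_int_eq_of_sigmaInt_eq k (by rw [map_add, sigmaInt_sigmaInt, add_comm])

/-- **`√Δ ∈ O_k`**: there is `θ ∈ O_k` with `θ² = Δ` and `σ θ = −θ` (★ `exists_mul_self_eq_discr`). [folklore] -/
private theorem exists_sqrt_discr : ∃ θ : 𝓞 k, θ * θ = (NumberField.discr k : 𝓞 k) ∧ sigmaInt k θ = -θ := by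
  obtain ⟨θ, hθ, hσ⟩ := exists_mul_self_eq_discr k
  have hθ' : θ * θ = ((NumberField.discr k : ℤ) : k) := by rw [hθ, map_intCast]
  have hint : IsIntegral ℤ θ := by
    refine ⟨X ^ 2 - C (NumberField.discr k), monic_X_pow_sub_C _ (by norm_num), ?_⟩
    rw [eval₂_sub, eval₂_X_pow, eval₂_C, sq, hθ', eq_intCast, sub_self]
  have hmem : θ ∈ integralClosure ℤ k := hint
  refine ⟨⟨θ, hmem⟩, RingOfIntegers.ext ?_, RingOfIntegers.ext ?_⟩
  · simp only [map_mul, map_intCast, RingOfIntegers.map_mk]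
    exact hθ'
  · change conj ℚ k (algebraMap (𝓞 k) k ⟨θ, hmem⟩) = algebraMap (𝓞 k) k (-⟨θ, hmem⟩)
    rw [map_neg, RingOfIntegers.map_mk, hσ]

variable {k}

/-- **`σ`-FIXED UNITS ARE NORMS modulo `v^M`** for a maximal ideal `v` of `O_k` above an ODD prime `p ∤ Δ`: if `u ∉ v` and `σ u ≡ u (mod v^M)` then
`t σ(t) ≡ u (mod v^M)` for some `t ∈ O_k`.  (`u ≡ m ∈ ℤ` with `p ∤ m` — `2u ≡ u + σu = Tr u` and `2` is invertible mod `p^M` —, and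
`a² − Δ b² ≡ m (mod p^M)` is solvable, so `t = a + b√Δ`; the shadow in `O_k` of «units are norms in unramified extensions».)
[cite: Serre1979, Ch. V §2 Prop. 3] -/
private theorem exists_mul_sigmaInt_sub_mem_pow {v : Ideal (𝓞 k)} {p : ℕ} [hp : Fact p.Prime]
    (hpv : (p : 𝓞 k) ∈ v) (hp2 : p ≠ 2) (hpΔ : ¬ (p : ℤ) ∣ NumberField.discr k) (M : ℕ) {u : 𝓞 k} (hu : u ∉ v)
    (hfix : sigmaInt k u - u ∈ v ^ M) : ∃ t : 𝓞 k, t * sigmaInt k t - u ∈ v ^ M := by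
  rcases Nat.eq_zero_or_pos M with hM | hM
  · subst hM
    exact ⟨0, by rw [pow_zero, Ideal.one_eq_top]; exact Submodule.mem_top⟩
  have hpM : ((p : 𝓞 k)) ^ M ∈ v ^ M := Ideal.pow_mem_pow hpv M
  -- `2 w ≡ 1 (mod p^M)`
  obtain ⟨w₀, hw₀⟩ : Odd (p ^ M) := (hp.out.odd_of_ne_two hp2).pow
  set w : ℤ := (w₀ : ℤ) + 1 with hw
  have h2w : (2 : ℤ) * w - 1 = (p : ℤ) ^ M := by
    have h : (((p ^ M : ℕ)) : ℤ) = 2 * w₀ + 1 := by exact_mod_cast hw₀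
    push_cast at h
    rw [hw, h]
    ring
  -- `u ≡ m (mod v^M)` with `m = w · Tr u ∈ ℤ`
  obtain ⟨m₀, hm₀⟩ := exists_int_eq_add_sigmaInt k u
  set m : ℤ := w * m₀ with hm
  have hum : u - (m : 𝓞 k) ∈ v ^ M := by
    have h1 : u - (m : 𝓞 k) = -((w : 𝓞 k) * (sigmaInt k u - u)) - (((2 : ℤ) * w - 1 : ℤ) : 𝓞 k) * u := by
      rw [hm]; push_cast; rw [hm₀]; ring
    rw [h1, h2w]
    push_cast
    exact Ideal.sub_mem _ ((v ^ M).neg_mem (Ideal.mul_mem_left _ _ hfix)) (Ideal.mul_mem_right _ _ hpM)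
  -- `p ∤ m`
  have hpm : ¬ (p : ℤ) ∣ m := by
    rintro ⟨c, hc⟩
    apply hu
    have hmv : (m : 𝓞 k) ∈ v := by
      rw [hc]; push_cast; exact Ideal.mul_mem_right _ _ hpv
    have h := Ideal.add_mem _ (Ideal.pow_le_self hM.ne' hum) hmv
    rwa [sub_add_cancel] at h
  -- `a² − Δ b² ≡ m (mod p^M)` and `t = a + b θ`
  obtain ⟨a, b, hab⟩ := exists_int_sq_sub_mul_sq_mod hp2 hpΔ hpm M
  obtain ⟨θ, hθ, hσθ⟩ := exists_sqrt_discr k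
  obtain ⟨z, hz⟩ := hab
  refine ⟨(a : 𝓞 k) + (b : 𝓞 k) * θ, ?_⟩
  have hnorm : ((a : 𝓞 k) + (b : 𝓞 k) * θ) * sigmaInt k ((a : 𝓞 k) + (b : 𝓞 k) * θ) - u =
      (((p : 𝓞 k)) ^ M * (z : 𝓞 k)) - (u - (m : 𝓞 k)) := by
    have h1 : (((a ^ 2 - NumberField.discr k * b ^ 2 - m : ℤ)) : 𝓞 k) = ((p : 𝓞 k)) ^ M * (z : 𝓞 k) := by
      rw [hz]; push_cast; ring
    rw [map_add, map_mul, map_intCast, map_intCast, hσθ, ← h1]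
    push_cast
    linear_combination (-(b : 𝓞 k) ^ 2) * hθ
  rw [hnorm]
  exact Ideal.sub_mem _ (Ideal.mul_mem_right _ _ hpM) hum

end NormMod

/-! ### The local step at a `σ`-stable prime: Jacobowitz over the local ring `O_k / v^M` -/

section LocalStep

variable {k : Type} [Field k] [NumberField k] [IsTotallyComplex k] [Algebra.IsQuadraticExtension ℚ k]

omit [NumberField k] [IsTotallyComplex k] [Algebra.IsQuadraticExtension ℚ k] in
/-- `a ∉ v`, `v` maximal ⇒ `a` is a unit modulo `v^M`. [folklore] -/
private theorem isUnit_mk_pow_of_notMem {v : Ideal (𝓞 k)} (hv : v.IsMaximal) {a : 𝓞 k} (ha : a ∉ v) (M : ℕ) :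
    IsUnit (Ideal.Quotient.mk (v ^ M) a) := by
  have hlt : v < v ⊔ Ideal.span {a} := lt_of_le_of_ne le_sup_left fun h =>
    ha (h ▸ Submodule.mem_sup_right (Ideal.mem_span_singleton_self a))
  have htop : v ^ M ⊔ Ideal.span {a} = ⊤ := Ideal.pow_sup_eq_top (hv.out.2 _ hlt)
  obtain ⟨x, hx, y, hy, hxy⟩ := Submodule.mem_sup.1 ((Ideal.eq_top_iff_one _).1 htop)
  obtain ⟨t, rfl⟩ := Ideal.mem_span_singleton'.1 hy
  refine isUnit_iff_exists_inv.2 ⟨Ideal.Quotient.mk (v ^ M) t, ?_⟩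
  rw [← map_mul, ← map_one (Ideal.Quotient.mk (v ^ M)), Ideal.Quotient.eq]
  have h : a * t - 1 = -x := by linear_combination hxy
  rw [h]
  exact (v ^ M).neg_mem hx

omit [NumberField k] [IsTotallyComplex k] [Algebra.IsQuadraticExtension ℚ k] in
/-- `O_k / v^M` (`v` maximal, `M ≥ 1`) is a local ring: an element is a unit or its complement to `1` is. [folklore] -/
private theorem isLocalRing_quotient_pow {v : Ideal (𝓞 k)} (hv : v.IsMaximal) {M : ℕ} (hM : M ≠ 0) :
    IsLocalRing (𝓞 k ⧸ v ^ M) := by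
  haveI : Nontrivial (𝓞 k ⧸ v ^ M) :=
    Ideal.Quotient.nontrivial_iff.2 fun h => hv.ne_top (top_le_iff.1 (h ▸ Ideal.pow_le_self hM))
  refine IsLocalRing.of_isUnit_or_isUnit_one_sub_self fun a => ?_
  obtain ⟨a, rfl⟩ := Ideal.Quotient.mk_surjective a
  by_cases ha : a ∈ v
  · right
    rw [← map_one (Ideal.Quotient.mk (v ^ M)), ← map_sub]
    refine isUnit_mk_pow_of_notMem hv (fun h => hv.ne_top ((Ideal.eq_top_iff_one _).2 ?_)) M
    have h1 := v.add_mem h ha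
    rwa [sub_add_cancel] at h1
  · exact Or.inl (isUnit_mk_pow_of_notMem hv ha M)

/-- **THE LOCAL STEP AT A `σ`-STABLE PRIME** `v ∣ N` (over an odd `p ∤ Δ`): two `σ`-hermitian matrices `G, A ∈ M_n(O_k)` with determinants
`∉ v` are congruent modulo `v^M`: `ᵗ(σT) G T ≡ A (mod v^M)`.  `O_k/v^M` is a local ring with the involution induced by `σ`, (trace) holds with
`b = ½`, (norm) by `exists_mul_sigmaInt_sub_mem_pow`; hence Jacobowitz's theorem ★ `HermitianUnimodular.exists_formCongr_eq` applies, and the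
congruence matrix lifts to `O_k`. [cite: Jacobowitz1962, §7 Thm. 7.1] -/
private theorem exists_congr_mod_pow_of_stable {v : Ideal (𝓞 k)} (hv : v.IsMaximal) (hσv : ∀ x ∈ v, sigmaInt k x ∈ v)
    {p : ℕ} [hp : Fact p.Prime] (hpv : (p : 𝓞 k) ∈ v) (hp2 : p ≠ 2) (hpΔ : ¬ (p : ℤ) ∣ NumberField.discr k) {M : ℕ} (hM : M ≠ 0)
    {n : ℕ} (G A : Matrix (Fin n) (Fin n) (𝓞 k)) (hG : (G.map (sigmaInt k))ᵀ = G) (hGdet : G.det ∉ v)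
    (hA : (A.map (sigmaInt k))ᵀ = A) (hAdet : A.det ∉ v) :
    ∃ T : Matrix (Fin n) (Fin n) (𝓞 k),
      ((T.map (sigmaInt k))ᵀ * G * T).map (Ideal.Quotient.mk (v ^ M)) = A.map (Ideal.Quotient.mk (v ^ M)) := by
  classical
  haveI : IsLocalRing (𝓞 k ⧸ v ^ M) := isLocalRing_quotient_pow hv hM
  have hle : v ^ M ≤ (v ^ M).comap (sigmaInt k : 𝓞 k →+* 𝓞 k) := by
    refine le_trans (Ideal.pow_right_mono (I := v) (J := v.comap (sigmaInt k : 𝓞 k →+* 𝓞 k)) (fun x hx => hσv x hx) M) ?_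
    exact Ideal.le_comap_pow _ M
  set π : 𝓞 k →+* 𝓞 k ⧸ v ^ M := Ideal.Quotient.mk (v ^ M) with hπ
  set σv : 𝓞 k ⧸ v ^ M →+* 𝓞 k ⧸ v ^ M := Ideal.quotientMap (v ^ M) (sigmaInt k : 𝓞 k →+* 𝓞 k) hle with hσv'
  have hσπ : ∀ x, σv (π x) = π (sigmaInt k x) := fun x => Ideal.quotientMap_mk
  have hcomp : (σv : 𝓞 k ⧸ v ^ M → 𝓞 k ⧸ v ^ M) ∘ π = π ∘ (sigmaInt k) := funext fun x => hσπ x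
  have hσσ : ∀ x, σv (σv x) = x := by
    intro x
    obtain ⟨x, rfl⟩ := Ideal.Quotient.mk_surjective x
    rw [← hπ, hσπ, hσπ, sigmaInt_sigmaInt]
  -- (trace): `b = w` with `2w ≡ 1`
  have hpM : ((p : 𝓞 k)) ^ M ∈ v ^ M := Ideal.pow_mem_pow hpv M
  obtain ⟨w₀, hw₀⟩ : Odd (p ^ M) := (hp.out.odd_of_ne_two hp2).pow
  have htr : ∃ b : 𝓞 k ⧸ v ^ M, b + σv b = 1 := by
    refine ⟨π ((w₀ : 𝓞 k) + 1), ?_⟩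
    rw [hσπ, map_add (sigmaInt k), map_natCast (sigmaInt k), map_one (sigmaInt k), ← map_add π, ← map_one π, hπ,
      Ideal.Quotient.eq]
    have h : ((w₀ : 𝓞 k) + 1 + ((w₀ : 𝓞 k) + 1) - 1) = ((p ^ M : ℕ) : 𝓞 k) := by rw [hw₀]; push_cast; ring
    rw [h]
    push_cast
    exact hpM
  -- (norm)
  have hnorm : ∀ u : 𝓞 k ⧸ v ^ M, IsUnit u → σv u = u → ∃ t, t * σv t = u := by
    intro u hu hfix
    obtain ⟨u, rfl⟩ := Ideal.Quotient.mk_surjective u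
    have hu' : u ∉ v := by
      intro h
      have h0 : (Ideal.Quotient.mk (v ^ M) u) ^ M = 0 := by
        rw [← map_pow, Ideal.Quotient.eq_zero_iff_mem]
        exact Ideal.pow_mem_pow h M
      have h1 := (hu.pow M)
      rw [h0, isUnit_zero_iff] at h1
      exact zero_ne_one h1
    have hfix' : sigmaInt k u - u ∈ v ^ M := by
      rw [← Ideal.Quotient.eq, ← hπ, ← hσπ]
      exact hfix
    obtain ⟨t, ht⟩ := exists_mul_sigmaInt_sub_mem_pow (v := v) hpv hp2 hpΔ M hu' hfix'
    refine ⟨π t, ?_⟩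
    rw [hσπ, ← map_mul, ← hπ, Ideal.Quotient.eq]
    exact ht
  -- the matrices over `O_k / v^M`
  have hherm : ∀ B : Matrix (Fin n) (Fin n) (𝓞 k), (B.map (sigmaInt k))ᵀ = B → ((B.map π).map σv)ᵀ = B.map π := by
    intro B hB
    rw [Matrix.map_map, hcomp, ← Matrix.map_map, ← Matrix.transpose_map, hB]
  have hunit : ∀ B : Matrix (Fin n) (Fin n) (𝓞 k), B.det ∉ v → IsUnit (B.map π).det := by
    intro B hB
    rw [← RingHom.mapMatrix_apply, ← RingHom.map_det]
    exact isUnit_mk_pow_of_notMem hv hB M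
  obtain ⟨T, hT⟩ := Literature.NumberTheory.QuadraticForms.HermitianUnimodular.exists_formCongr_eq σv hσσ htr hnorm
    (A.map π) (G.map π) (hherm A hA) (hunit A hAdet) (hherm G hG) (hunit G hGdet)
  -- lift `T`
  choose T₀ hT₀ using fun i j => Ideal.Quotient.mk_surjective ((T : Matrix (Fin n) (Fin n) (𝓞 k ⧸ v ^ M)) i j)
  refine ⟨Matrix.of fun i j => T₀ i j, ?_⟩
  have hlift : (Matrix.of fun i j => T₀ i j).map π = (T : Matrix (Fin n) (Fin n) (𝓞 k ⧸ v ^ M)) := by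
    ext i j
    exact hT₀ i j
  have hmapσ : ((Matrix.of fun i j => T₀ i j).map (sigmaInt k)).map π =
      ((T : Matrix (Fin n) (Fin n) (𝓞 k ⧸ v ^ M))).map σv := by
    rw [Matrix.map_map, ← hcomp, ← Matrix.map_map, hlift]
  calc (((Matrix.of fun i j => T₀ i j).map (sigmaInt k))ᵀ * G * Matrix.of fun i j => T₀ i j).map π
      = (((Matrix.of fun i j => T₀ i j).map (sigmaInt k)).map π)ᵀ * G.map π *
          (Matrix.of fun i j => T₀ i j).map π := by
        rw [Matrix.map_mul, Matrix.map_mul, Matrix.transpose_map]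
    _ = formCongr σv T (G.map π) := by rw [hmapσ, hlift]
    _ = A.map π := hT

end LocalStep

/-! ### The split step and Chinese-remainder gluing (any commutative ring with involution) -/

section Glue

variable {R : Type*} [CommRing R] (σ : R →+* R)

/-- `σ` fixes the determinant of a `σ`-hermitian matrix: `σ(det H) = det ᵗ(σH) = det H`. [folklore] -/
private theorem map_det_of_hermitian {n : ℕ} {H : Matrix (Fin n) (Fin n) R} (hH : (H.map σ)ᵀ = H) : σ H.det = H.det := by
  have h := (σ : R →+* R).map_det H
  rw [RingHom.mapMatrix_apply] at h
  rw [h, ← Matrix.det_transpose, hH]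

/-- **The split step, first member of a pair**: with `T = t · adj(G) · A` and partner `1`, `ᵗ(σ1) · G · T = (t · det G) · A ≡ A (mod I)` when
`t · det G ≡ 1 (mod I)`. [folklore] -/
private theorem adjStep_self {n : ℕ} (G A : Matrix (Fin n) (Fin n) R) (I : Ideal R) {t : R} (ht : t * G.det - 1 ∈ I) :
    (((1 : Matrix (Fin n) (Fin n) R).map σ)ᵀ * G * (t • (G.adjugate * A))).map (Ideal.Quotient.mk I) =
      A.map (Ideal.Quotient.mk I) := by
  rw [Matrix.map_one σ (map_zero σ) (map_one σ), Matrix.transpose_one, Matrix.one_mul, Matrix.mul_smul, ← Matrix.mul_assoc,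
    Matrix.mul_adjugate, Matrix.smul_mul, Matrix.one_mul, smul_smul]
  ext i j
  rw [Matrix.map_apply, Matrix.map_apply, Matrix.smul_apply, smul_eq_mul, Ideal.Quotient.eq]
  have h : t * G.det * A i j - A i j = (t * G.det - 1) * A i j := by ring
  rw [h]
  exact I.mul_mem_right _ ht

/-- **The split step, second member of a pair**: with `T = t · adj(G) · A` in the partner slot and `1` in its own slot,
`ᵗ(σT) · G · 1 = (σt · det G) · A ≡ A (mod J)` when `σ(t · det G − 1) ∈ J` (`G`, `A` `σ`-hermitian, `A ᵗA`-symmetric with `σA = A`). [folklore] -/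
private theorem adjStep_partner {n : ℕ} (G A : Matrix (Fin n) (Fin n) R) (hG : (G.map σ)ᵀ = G) (hAσ : A.map σ = A) (hAt : Aᵀ = A)
    (J : Ideal R) {t : R} (ht : σ (t * G.det - 1) ∈ J) :
    (((t • (G.adjugate * A)).map σ)ᵀ * G * (1 : Matrix (Fin n) (Fin n) R)).map (Ideal.Quotient.mk J) =
      A.map (Ideal.Quotient.mk J) := by
  have hadj : (G.adjugate.map σ)ᵀ = G.adjugate := by
    have h := (σ : R →+* R).map_adjugate G
    rw [RingHom.mapMatrix_apply, RingHom.mapMatrix_apply] at h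
    rw [h, Matrix.adjugate_transpose, hG]
  have hTσ : ((t • (G.adjugate * A)).map σ)ᵀ = σ t • (A * G.adjugate) := by
    rw [Matrix.map_smul' σ t _ (map_mul σ), Matrix.transpose_smul, Matrix.map_mul, Matrix.transpose_mul, hAσ, hAt, hadj]
  rw [Matrix.mul_one, hTσ, Matrix.smul_mul, Matrix.mul_assoc, Matrix.adjugate_mul, Matrix.mul_smul, Matrix.mul_one, smul_smul]
  ext i j
  rw [Matrix.map_apply, Matrix.map_apply, Matrix.smul_apply, smul_eq_mul, Ideal.Quotient.eq]
  have h : σ t * G.det * A i j - A i j = σ (t * G.det - 1) * A i j := by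
    rw [map_sub, map_mul, map_one, map_det_of_hermitian σ hG]; ring
  rw [h]
  exact J.mul_mem_right _ ht

/-- **Chinese-remainder gluing of congruence matrices.**  Index set `ι` with an involution `c`, ideals `I_i` with `σ(I_i) ⊆ I_{c i}`,
idempotent-like elements `ε_j ≡ [i = j] (mod I_i)`, and matrices `T_i` with `ᵗ(σ T_{c i}) H T_i ≡ B (mod I_i)`: then `T = Σ_j ε_j T_j` satisfies
`ᵗ(σT) H T ≡ B (mod I_i)` for every `i` (indeed `T ≡ T_i` and `σT ≡ σT_{c i}` modulo `I_i`). [folklore] -/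
private theorem glue_congr {ι : Type*} [Fintype ι] [DecidableEq ι] (c : ι → ι) (hcc : ∀ i, c (c i) = i) (I : ι → Ideal R)
    (hσI : ∀ i, ∀ x ∈ I i, σ x ∈ I (c i)) (ε : ι → R) (hε : ∀ i j, ε j - (if i = j then 1 else 0) ∈ I i)
    {n : ℕ} (H B : Matrix (Fin n) (Fin n) R) (T : ι → Matrix (Fin n) (Fin n) R)
    (hT : ∀ i, (((T (c i)).map σ)ᵀ * H * T i).map (Ideal.Quotient.mk (I i)) = B.map (Ideal.Quotient.mk (I i))) (i : ι) :
    (((∑ j, ε j • T j).map σ)ᵀ * H * (∑ j, ε j • T j)).map (Ideal.Quotient.mk (I i)) = B.map (Ideal.Quotient.mk (I i)) := by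
  set π := Ideal.Quotient.mk (I i) with hπ
  have hε1 : ∀ j, π (ε j) = if i = j then 1 else 0 := by
    intro j
    have h := (Ideal.Quotient.eq (I := I i)).2 (hε i j)
    rw [h]
    split_ifs <;> simp
  have hε2 : ∀ j, π (σ (ε j)) = if c i = j then 1 else 0 := by
    intro j
    have h1 : σ (ε j) - (if c i = j then 1 else 0) ∈ I i := by
      have h := hσI (c i) _ (hε (c i) j)
      rw [hcc, map_sub] at h
      have h2 : σ (if c i = j then (1 : R) else 0) = if c i = j then 1 else 0 := by split_ifs <;> simp
      rwa [h2] at h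
    have h := (Ideal.Quotient.eq (I := I i)).2 h1
    rw [h]
    split_ifs <;> simp
  have hsum : (∑ j, ε j • T j).map π = (T i).map π := by
    ext a b
    simp only [Matrix.map_apply, Matrix.sum_apply, Matrix.smul_apply, smul_eq_mul, map_sum, map_mul, hε1, ite_mul, one_mul,
      zero_mul, Finset.sum_ite_eq, Finset.mem_univ, if_true]
  have hsumσ : ((∑ j, ε j • T j).map σ).map π = ((T (c i)).map σ).map π := by
    ext a b
    simp only [Matrix.map_apply, Matrix.sum_apply, Matrix.smul_apply, smul_eq_mul, map_sum, map_mul, hε2, ite_mul, one_mul,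
      zero_mul, Finset.sum_ite_eq, Finset.mem_univ, if_true]
  rw [Matrix.map_mul, Matrix.map_mul, Matrix.transpose_map, hsumσ, hsum, ← Matrix.transpose_map, ← Matrix.map_mul,
    ← Matrix.map_mul]
  exact hT i

end Glue

/-! ### The standard form `antidiag(1, …, 1)` -/

section Std

variable {R : Type*} [CommRing R] {n : ℕ}

/-- `antidiag(1, …, 1)` is symmetric. [folklore] -/
private theorem stdHermMatrix_transpose : (stdHermMatrix n R)ᵀ = stdHermMatrix n R := by
  ext i j
  simp only [stdHermMatrix, Matrix.transpose_apply, Matrix.of_apply]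
  exact if_congr (by omega) rfl rfl

/-- `antidiag(1, …, 1)` has entries `0, 1`, fixed by any ring endomorphism. [folklore] -/
private theorem stdHermMatrix_map (σ : R →+* R) : (stdHermMatrix n R).map σ = stdHermMatrix n R := by
  ext i j
  simp only [stdHermMatrix, Matrix.map_apply, Matrix.of_apply]
  split_ifs <;> simp

/-- `antidiag(1, …, 1)² = 1`. [folklore] -/
private theorem stdHermMatrix_mul_self : stdHermMatrix n R * stdHermMatrix n R = 1 := by
  ext i j
  have hi : n - 1 - (i : ℕ) < n := by omega
  rw [Matrix.mul_apply, Finset.sum_eq_single ⟨n - 1 - (i : ℕ), hi⟩]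
  · simp only [stdHermMatrix, Matrix.of_apply, Matrix.one_apply, Fin.ext_iff]
    have h1 : (i : ℕ) + (n - 1 - (i : ℕ)) + 1 = n := by omega
    rw [if_pos h1, one_mul]
    exact if_congr (by constructor <;> intro h <;> omega) rfl rfl
  · intro l _ hl
    simp only [stdHermMatrix, Matrix.of_apply]
    rw [if_neg, zero_mul]
    intro h
    apply hl
    exact Fin.ext (by simp only; omega)
  · intro h
    exact absurd (Finset.mem_univ _) h

/-- `det antidiag(1, …, 1)` is a unit (`= ±1`). [folklore] -/
private theorem isUnit_det_stdHermMatrix : IsUnit (stdHermMatrix n R).det :=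
  IsUnit.of_mul_eq_one (stdHermMatrix n R).det (by rw [← Matrix.det_mul, stdHermMatrix_mul_self, Matrix.det_one])

end Std

/-! ### Gluing over the primes dividing `N O_k`: the theorem -/

section Main

variable (k : Type) [Field k] [NumberField k] [IsTotallyComplex k] [Algebra.IsQuadraticExtension ℚ k]

omit [IsTotallyComplex k] [Algebra.IsQuadraticExtension ℚ k] in
/-- A maximal ideal containing the odd integer `N` prime to `Δ` contains an odd rational prime `p ∤ Δ` (the residue characteristic).
[folklore] -/
private theorem exists_prime_mem {v : Ideal (𝓞 k)} (hv : v.IsMaximal) {N : ℕ} (hN : Odd N) (hN0 : 0 < N)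
    (hcop : N.Coprime (NumberField.discr k).natAbs) (hNv : (N : 𝓞 k) ∈ v) :
    ∃ p : ℕ, p.Prime ∧ (p : 𝓞 k) ∈ v ∧ p ≠ 2 ∧ ¬ (p : ℤ) ∣ NumberField.discr k := by
  letI := Ideal.Quotient.field v
  obtain ⟨p, hchar⟩ := CharP.exists (𝓞 k ⧸ v)
  have hpv : (p : 𝓞 k) ∈ v := by
    rw [← Ideal.Quotient.eq_zero_iff_mem, map_natCast]
    exact CharP.cast_eq_zero (𝓞 k ⧸ v) p
  have hpN : p ∣ N := (CharP.cast_eq_zero_iff (𝓞 k ⧸ v) p N).1 (by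
    rw [← map_natCast (Ideal.Quotient.mk v), Ideal.Quotient.eq_zero_iff_mem]; exact hNv)
  have hp0 : p ≠ 0 := by
    rintro rfl
    rw [zero_dvd_iff] at hpN
    omega
  have hp : p.Prime := (CharP.char_is_prime_or_zero (𝓞 k ⧸ v) p).resolve_right hp0
  refine ⟨p, hp, hpv, ?_, ?_⟩
  · rintro rfl
    have h := Nat.odd_iff.1 (hN.of_dvd_nat hpN)
    norm_num at h
  · intro h
    have h1 : p ∣ (NumberField.discr k).natAbs := Int.natCast_dvd.1 h
    exact hp.one_lt.ne' ((Nat.Coprime.coprime_dvd_left hpN hcop).eq_one_of_dvd h1)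

/-- **UNIMODULAR `σ`-HERMITIAN MATRICES OVER `O_k` ARE CONGRUENT TO THE STANDARD FORM MODULO `N`** — the matrix form of
[KR2013 §13.2, after Def. 13.5] «if `L` is a self-dual `O_k`-module, then `L/NL` is isomorphic to `(O_k/N O_k)ⁿ` with the standard form»:
for `N` odd, positive and prime to `Δ`, and `G ∈ M_n(O_k)` with `ᵗ(σG) = G` and `det G` a unit modulo `N`, there is `T ∈ M_n(O_k)` with
`ᵗ(σT) G T ≡ antidiag(1, …, 1) (mod N O_k)` (★ `stdHermMatrix`).  Proof: Chinese-remainder gluing (`glue_congr`) of Jacobowitz's theorem at the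
`σ`-stable primes `v ∣ N` (`exists_congr_mod_pow_of_stable`, [Jacobowitz1962, Thm. 7.1] over the local rings `O_k/v^M`) and of the adjugate trick
at the split pairs. [cite: KudlaRapoport2013, §13.2 (arXiv v2 p. 50)] [cite: Jacobowitz1962, §7 Thm. 7.1] -/
theorem HermitianGram.exists_congr_stdHermMatrix_mod {N : ℕ} (hN : Odd N) (hN0 : 0 < N) (hcop : N.Coprime (absDisc k))
    {n : ℕ} (G : Matrix (Fin n) (Fin n) (𝓞 k)) (hG : (G.map (sigmaInt k))ᵀ = G)
    (hdet : IsUnit (Ideal.Quotient.mk (Ideal.span {((N : ℤ) : 𝓞 k)}) G.det)) :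
    ∃ T : Matrix (Fin n) (Fin n) (𝓞 k), ∀ i j,
      ((T.map (sigmaInt k))ᵀ * G * T) i j - stdHermMatrix n (𝓞 k) i j ∈ Ideal.span {((N : ℤ) : 𝓞 k)} := by
  classical
  set 𝔫 : Ideal (𝓞 k) := Ideal.span {((N : ℤ) : 𝓞 k)} with h𝔫
  set A : Matrix (Fin n) (Fin n) (𝓞 k) := stdHermMatrix n (𝓞 k) with hA
  set σ₀ : 𝓞 k →+* 𝓞 k := (sigmaInt k : 𝓞 k →+* 𝓞 k) with hσ₀
  have hG' : (G.map σ₀)ᵀ = G := hG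
  have hAσ : A.map σ₀ = A := stdHermMatrix_map σ₀
  have hAt : Aᵀ = A := stdHermMatrix_transpose
  have hAherm : (A.map (sigmaInt k))ᵀ = A := by
    change (A.map σ₀)ᵀ = A
    rw [hAσ, hAt]
  -- `N = 1`: everything is congruent modulo `O_k`
  by_cases hN1 : N = 1
  · refine ⟨0, fun i j => ?_⟩
    have htop : 𝔫 = ⊤ := by rw [h𝔫, hN1]; simp
    rw [htop]
    exact Submodule.mem_top
  have h𝔫0 : 𝔫 ≠ ⊥ := by
    rw [h𝔫, Ne, Ideal.span_singleton_eq_bot]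
    exact_mod_cast hN0.ne'
  have h𝔫1 : 𝔫 ≠ ⊤ := by
    rw [h𝔫, Ne, Ideal.span_singleton_eq_top]
    intro hu
    have h := Literature.NumberTheory.QuadraticFields.Quadratic.isUnit_of_isUnit_intCast (K := k) hu
    have h2 : ((N : ℤ)).natAbs = 1 := Int.natAbs_of_isUnit h
    omega
  have hNmem : (((N : ℤ)) : 𝓞 k) ∈ 𝔫 := Ideal.mem_span_singleton_self _
  -- the primes dividing `𝔫`, a uniform exponent, and membership in `𝔫`
  set s : Finset (HeightOneSpectrum (𝓞 k)) := (Ideal.finite_factors h𝔫0).toFinset with hs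
  have hmem_s : ∀ v : HeightOneSpectrum (𝓞 k), v ∈ s ↔ v.asIdeal ∣ 𝔫 := fun v => by
    rw [hs, Set.Finite.mem_toFinset]; rfl
  set e : HeightOneSpectrum (𝓞 k) → ℕ := fun v => (Associates.mk v.asIdeal).count (Associates.mk 𝔫).factors with he
  set M : ℕ := s.sup e + 1 with hM
  have hM0 : M ≠ 0 := Nat.succ_ne_zero _
  have heM : ∀ v ∈ s, e v ≤ M := fun v hv => (Finset.le_sup (f := e) hv).trans (Nat.le_succ _)
  have hmem𝔫 : ∀ x : 𝓞 k, (∀ v ∈ s, x ∈ v.asIdeal ^ M) → x ∈ 𝔫 := by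
    intro x hx
    rw [← Ideal.iInf_maxPowDividing_eq h𝔫0, Submodule.mem_iInf]
    intro v
    change x ∈ v.asIdeal ^ e v
    by_cases hv : v ∈ s
    · exact Ideal.pow_le_pow_right (heM v hv) (hx v hv)
    · have h0 : e v = 0 := by
        by_contra hne
        exact hv ((hmem_s v).2 ((Associates.count_ne_zero_iff_dvd h𝔫0 v.irreducible).1 hne))
      rw [h0, pow_zero, Ideal.one_eq_top]
      exact Submodule.mem_top
  -- `σ` on ideals and on the primes dividing `𝔫`
  set cI : Ideal (𝓞 k) → Ideal (𝓞 k) := fun I => I.map (sigmaInt k) with hcI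
  have hcImem : ∀ (I : Ideal (𝓞 k)), ∀ x ∈ I, sigmaInt k x ∈ cI I := fun I x hx => Ideal.mem_map_of_mem _ hx
  have hcIcI : ∀ I, cI (cI I) = I := by
    intro I
    apply le_antisymm
    · rw [hcI]
      dsimp only
      rw [Ideal.map_le_iff_le_comap, Ideal.map_le_iff_le_comap]
      intro x hx
      rw [Ideal.mem_comap, Ideal.mem_comap, sigmaInt_sigmaInt]
      exact hx
    · intro x hx
      have h := hcImem _ _ (hcImem _ _ hx)
      rwa [sigmaInt_sigmaInt] at h
  have hcI𝔫 : cI 𝔫 = 𝔫 := by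
    rw [hcI]
    dsimp only
    rw [h𝔫, Ideal.map_span, Set.image_singleton, map_intCast]
  have hcIdvd : ∀ I : Ideal (𝓞 k), I ∣ 𝔫 → cI I ∣ 𝔫 := fun I h => by
    rw [Ideal.dvd_iff_le] at h ⊢
    rw [← hcI𝔫]
    exact Ideal.map_mono h
  have hcIpow : ∀ I : Ideal (𝓞 k), cI (I ^ M) = cI I ^ M := fun I => Ideal.map_pow _ _ M
  have hcV : ∀ v : HeightOneSpectrum (𝓞 k), ∃ w : HeightOneSpectrum (𝓞 k), w.asIdeal = cI v.asIdeal := fun v =>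
    ⟨⟨cI v.asIdeal, by haveI := v.isPrime; exact Ideal.map_isPrime_of_equiv (sigmaInt k),
      fun h => v.ne_bot ((Ideal.map_eq_bot_iff_of_injective (sigmaInt k).injective).1 h)⟩, rfl⟩
  choose cV hcV using hcV
  have hcVs : ∀ v ∈ s, cV v ∈ s := fun v hv => (hmem_s _).2 (by rw [hcV]; exact hcIdvd _ ((hmem_s v).1 hv))
  have hcVcV : ∀ v, cV (cV v) = v := fun v => HeightOneSpectrum.ext (by rw [hcV, hcV, hcIcI])
  -- the index type, its involution, the ideals `v^M`
  set c : s → s := fun v => ⟨cV v.1, hcVs v.1 v.2⟩ with hc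
  have hcc : ∀ i : s, c (c i) = i := fun i => Subtype.ext (hcVcV i.1)
  have hc1 : ∀ i : s, (c i).1.asIdeal = cI i.1.asIdeal := fun i => hcV i.1
  set I : s → Ideal (𝓞 k) := fun v => v.1.asIdeal ^ M with hI
  have hσI : ∀ i : s, ∀ x ∈ I i, σ₀ x ∈ I (c i) := by
    intro i x hx
    change sigmaInt k x ∈ (c i).1.asIdeal ^ M
    rw [hc1, ← hcIpow]
    exact hcImem _ x hx
  -- Chinese-remainder idempotents
  have hε : ∀ i : s, ∃ ε : 𝓞 k, ∀ j : s, ε - (if j = i then 1 else 0) ∈ I j := by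
    intro i
    obtain ⟨y, hy⟩ := IsDedekindDomain.exists_forall_sub_mem_ideal (s := s) (fun v => v.asIdeal) (fun _ => M)
      (fun v _ => v.prime) (fun v _ w _ hne h => hne (HeightOneSpectrum.ext h)) (fun w => if w = i then 1 else 0)
    exact ⟨y, fun j => hy j.1 j.2⟩
  choose ε hε using hε
  -- maximality of the `v`, and the determinants are units modulo every `v`
  have hmax : ∀ i : s, i.1.asIdeal.IsMaximal := fun i => i.1.isPrime.isMaximal i.1.ne_bot
  have h𝔫le : ∀ i : s, 𝔫 ≤ i.1.asIdeal := fun i => Ideal.le_of_dvd ((hmem_s _).1 i.2)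
  have hGdet : ∀ i : s, G.det ∉ i.1.asIdeal := by
    intro i hmem
    obtain ⟨u, hu⟩ := isUnit_iff_exists_inv.1 hdet
    obtain ⟨t, rfl⟩ := Ideal.Quotient.mk_surjective u
    rw [← map_mul, ← map_one (Ideal.Quotient.mk 𝔫), Ideal.Quotient.eq] at hu
    apply (hmax i).ne_top ((Ideal.eq_top_iff_one _).2 _)
    have h1 := Ideal.sub_mem _ (Ideal.mul_mem_right t _ hmem) (h𝔫le i hu)
    rwa [sub_sub_cancel] at h1
  have hAdet : ∀ i : s, A.det ∉ i.1.asIdeal := fun i h =>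
    (hmax i).ne_top (Ideal.eq_top_of_isUnit_mem _ h isUnit_det_stdHermMatrix)
  -- Jacobowitz at the `σ`-stable primes
  have hB : ∀ i : s, ∃ T : Matrix (Fin n) (Fin n) (𝓞 k), c i = i →
      ((T.map (sigmaInt k))ᵀ * G * T).map (Ideal.Quotient.mk (I i)) = A.map (Ideal.Quotient.mk (I i)) := by
    intro i
    by_cases hci : c i = i
    · have hσv : ∀ x ∈ i.1.asIdeal, sigmaInt k x ∈ i.1.asIdeal := by
        intro x hx
        have h := hcImem _ x hx
        rwa [← hc1, hci] at h
      obtain ⟨p, hp, hpv, hp2, hpΔ⟩ := exists_prime_mem k (hmax i) hN hN0 hcop (h𝔫le i (by exact_mod_cast hNmem))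
      haveI : Fact p.Prime := ⟨hp⟩
      obtain ⟨T, hT⟩ := exists_congr_mod_pow_of_stable (hmax i) hσv hpv hp2 hpΔ hM0 G A hG (hGdet i) hAherm (hAdet i)
      exact ⟨T, fun _ => hT⟩
    · exact ⟨0, fun h => absurd h hci⟩
  choose TB hTB using hB
  -- `t_i · det G ≡ 1 (mod v_i^M)`
  have ht : ∀ i : s, ∃ t : 𝓞 k, t * G.det - 1 ∈ I i := by
    intro i
    obtain ⟨u, hu⟩ := isUnit_iff_exists_inv.1 (isUnit_mk_pow_of_notMem (hmax i) (hGdet i) M)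
    obtain ⟨t, rfl⟩ := Ideal.Quotient.mk_surjective u
    refine ⟨t, ?_⟩
    rw [← Ideal.Quotient.eq, map_mul, map_one, mul_comm]
    exact hu
  choose tI htI using ht
  -- representatives of the split pairs `{v, σv}`
  set rep : s → s := fun i => @Classical.epsilon s ⟨i⟩ (fun w : s => w = i ∨ w = c i) with hrepdef
  have hrep : ∀ i, rep i = i ∨ rep i = c i := fun i => by
    rw [hrepdef]
    exact Classical.epsilon_spec (p := fun w : s => w = i ∨ w = c i) ⟨i, Or.inl rfl⟩
  have hrepc : ∀ i, rep (c i) = rep i := by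
    intro i
    rw [hrepdef]
    dsimp only
    rw [hcc]
    congr 1
    funext w
    exact propext or_comm
  -- the local congruence matrices
  set T : s → Matrix (Fin n) (Fin n) (𝓞 k) := fun i =>
    if c i = i then TB i else if rep i = i then tI i • (G.adjugate * A) else 1 with hTdef
  have hT : ∀ i : s, (((T (c i)).map σ₀)ᵀ * G * T i).map (Ideal.Quotient.mk (I i)) = A.map (Ideal.Quotient.mk (I i)) := by
    intro i
    by_cases hci : c i = i
    · have hTi : T i = TB i := by rw [hTdef]; dsimp only; rw [if_pos hci]
      rw [hci, hTi]
      exact hTB i hci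
    · have hcne : c (c i) ≠ c i := by rw [hcc]; exact Ne.symm hci
      rcases hrep i with hri | hri
      · have hTi : T i = tI i • (G.adjugate * A) := by rw [hTdef]; dsimp only; rw [if_neg hci, if_pos hri]
        have hTci : T (c i) = 1 := by
          have h1 : rep (c i) ≠ c i := by rw [hrepc, hri]; exact Ne.symm hci
          rw [hTdef]; dsimp only; rw [if_neg hcne, if_neg h1]
        rw [hTi, hTci]
        exact adjStep_self σ₀ G A (I i) (htI i)
      · have hri' : rep i ≠ i := by rw [hri]; exact hci
        have hTi : T i = 1 := by rw [hTdef]; dsimp only; rw [if_neg hci, if_neg hri']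
        have hTci : T (c i) = tI (c i) • (G.adjugate * A) := by
          have h1 : rep (c i) = c i := by rw [hrepc, hri]
          rw [hTdef]; dsimp only; rw [if_neg hcne, if_pos h1]
        rw [hTi, hTci]
        refine adjStep_partner σ₀ G A hG' hAσ hAt (I i) ?_
        have h := hσI (c i) _ (htI (c i))
        rwa [hcc] at h
  -- glue
  refine ⟨∑ j, ε j • T j, fun a b => hmem𝔫 _ fun v hv => ?_⟩
  have h := glue_congr σ₀ c hcc I hσI ε (fun i j => hε j i) G A T hT ⟨v, hv⟩
  have h2 := congrFun (congrFun h a) b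
  rw [Matrix.map_apply, Matrix.map_apply, Ideal.Quotient.eq] at h2
  exact h2

end Main

end Literature.AlgebraicGeometry.ShimuraVarieties.KudlaRapoport2013.Sec13LevelStructures

end
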